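import Literature.AlgebraicGeometry.ModuliOfAbelianVarieties.SiegelCMReciprocitySimilitude
import Literature.AlgebraicGeometry.ModuliOfAbelianVarieties.SiegelCMStructureFreeRankOne
import HarnessLib

/-!
# `𝔸_{ℚ,f}^{2g}` is free of rank one over `F ⊗ 𝔸_{ℚ,f} = ∏ᵢ 𝔸_{Kᵢ,f}` through the reciprocity representation `R(t)`
# ([Deligne 1971] 3.9 / 4.18: the torus `Res F^×` of a special pair acting on `V ⊗ 𝔸_f`; [Milne 2005] Def. 12.8 (60)–(62))

Topic `AlgebraicGeometry/ModuliOfAbelianVarieties`; namespace `Literature.AlgebraicGeometry.ModuliOfAbelianVarieties.CMStructure`.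
Cell hodgecm-mathlib (D-0151), fan B, layer (σ4)-D of the Siegel canonical model; a banked GENERIC leaf toward row I-7 (#60)
`SiegelS1` (director s86 (2)(b), #60-road item R60-14b; the carrier of MUMFORD-LINE-SPEC §3 step 5 «`r(s)` acts on
`𝔸_f^{2g} = F ⊗ 𝔸_f` as multiplication by the reflex-norm tuple, so `ℚ^{2g} ∩ (r(s)a)·ẑ^{2g} = N_Φ(s)·L_a`»).  THEOREMS ONLY:
no definition, no named fact, no instance, no `sorry` (D-0026, net Literature debt 0).

## The print

* [Deligne1971TravauxShimura] 3.9 (p. 140) and 4.18 (p. 150): for the special pair `(T = Res F^×, h)` the group `T(𝔸_f) = (F ⊗ 𝔸_f)^× =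
  ∏ᵢ 𝔸_{Kᵢ,f}^×` acts on `V ⊗ 𝔸_f`, and the reciprocity morphism `r(T, μ_h)` sends an idèle `s` of `E` to the reflex-norm tuple;
  [Milne2005ShimuraVarieties] Def. 12.8 (60)–(62) p. 114: `σ[x, a] = [x, r_x(s)·a]`.  The tree's ★ `CMStructure.cmRepMatrix c t` is the
  matrix `R(t)` of `t ∈ ∏ᵢ 𝔸_{Kᵢ,f}` acting on `𝔸_{ℚ,f}^{2g}` through `act` (★ `cmRepMatrix_eq_algHom`: the value of an `𝔸_{ℚ,f}`-algebra
  homomorphism extending `act`; ★ `cmRepMatrix_mul`), and ★ `cmRecipMatrix c Φ E s = R((N_{E,Φᵢ}(s))ᵢ)`.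
* [Milne2005ShimuraVarieties] §14 Def. 14.9 p. 123 / Cor. 14.11 p. 124: `H₁(A, ℚ) ≅ V` is free of rank one over the CM algebra `E` — proved
  over `ℚ` for every `CMStructure` in ★ R60-14 (`SiegelCMStructureFreeRankOne`: a cyclic vector `v`, `x ↦ act(x)·v : F ≅ ℚ^{2g}`).

## What is proved (all for `c : CMStructure g δ ι K`)

* `cmRepMatrix_mul_mulVec` — `R(t·u)·w = R(t)·(R(u)·w)` (★ `cmRepMatrix_mul`): the orbit map `Θ_w : u ↦ R(u)·w` is `∏ᵢ 𝔸_{Kᵢ,f}`-equivariant;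
  `image_cmRepMatrix_mulVec_image` — its set form `R(t)·Θ_w(S) = Θ_w(t·S)`.
* `map_actMatrix_mulVec_algebraMap` — `(act x)_𝔸 · (v ⊗ 1) = (act(x)·v) ⊗ 1`.
* **`bijective_cmRepMatrix_mulVec_of_bijective_act`** — if `v ∈ ℚ^{2g}` is a cyclic vector (`x ↦ act(x)·v` bijective, ★ R60-14) then
  `Θ_{v ⊗ 1} : ∏ᵢ 𝔸_{Kᵢ,f} → 𝔸_{ℚ,f}^{2g}`, `t ↦ R(t)·(v ⊗ 1)`, is a BIJECTION: it is the base change `𝔸_{ℚ,f} ⊗_ℚ (F ≅ ℚ^{2g})` read through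
  `∏ᵢ (𝔸_{ℚ,f} ⊗ Kᵢ) ≅ 𝔸_{ℚ,f} ⊗ F` (`Algebra.TensorProduct.piRight`), `𝔸_{ℚ,f} ⊗ ℚ^{2g} ≅ 𝔸_{ℚ,f}^{2g}` (`TensorProduct.piScalarRight`) and
  `𝔸_{ℚ,f} ⊗ Kᵢ ≅ 𝔸_{Kᵢ,f}` (★ `ratFiniteAdeleTensorEquiv`), the comparison with ★ `exists_algHom_extending_actMatrix` being checked on pure
  tensors (`TensorProduct.AlgebraTensorModule.ext`).
* **`exists_bijective_cmRepMatrix_mulVec`** — such a `w = v ⊗ 1` exists: `𝔸_{ℚ,f}^{2g}` is free of rank one over `∏ᵢ 𝔸_{Kᵢ,f}` through `R`.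

## References
* [Deligne1971TravauxShimura] P. Deligne, *Travaux de Shimura*, Sém. Bourbaki 389 (1971), 3.9 p. 140, 4.18 p. 150.
* [Milne2005ShimuraVarieties] J. S. Milne, *Introduction to Shimura varieties* (2005), Def. 12.8 (60)–(62) p. 114; §14 Def. 14.9 p. 123, Cor. 14.11 p. 124 (pages of the 2017 revision).
* [CasselsFrohlichANT1967] J. W. S. Cassels, A. Fröhlich (eds.), *Algebraic Number Theory* (1967), Ch. II §14 Lemma (14.2) (`𝔸_{K,f} ≅ 𝔸_{ℚ,f} ⊗ K`).
-/

noncomputable section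

open Module Function NumberField Matrix IsDedekindDomain
open scoped TensorProduct

namespace Literature.AlgebraicGeometry.ModuliOfAbelianVarieties

namespace CMStructure

open Literature.NumberTheory.ComplexMultiplication (ratFiniteAdeleTensorEquiv)

variable {g : ℕ} {δ : Fin g → ℕ} {ι : Type} [Fintype ι] [DecidableEq ι] {K : ι → Type} [∀ i, Field (K i)]
  [∀ i, NumberField (K i)] [∀ i, IsCMField (K i)] (c : CMStructure g δ ι K)

/-! ### §1. Equivariance of the orbit maps `u ↦ R(u)·w` -/

/-- **`R(t·u)·w = R(t)·(R(u)·w)`** — the orbit map `u ↦ R(u)·w` of any `w ∈ 𝔸_{ℚ,f}^{2g}` intertwines multiplication by `t` in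
`∏ᵢ 𝔸_{Kᵢ,f}` with `R(t)` (★ `cmRepMatrix_mul`). [cite: Deligne1971TravauxShimura, 3.9 p. 140 and 4.18 p. 150] -/
theorem cmRepMatrix_mul_mulVec (t u : Π i, FiniteAdeleRing (𝓞 (K i)) (K i)) (w : Fin g ⊕ Fin g → finAdeleQ) :
    c.cmRepMatrix (t * u) *ᵥ w = c.cmRepMatrix t *ᵥ (c.cmRepMatrix u *ᵥ w) := by
  rw [c.cmRepMatrix_mul, Matrix.mulVec_mulVec]

/-- Set form of the equivariance: `R(t)·Θ_w(S) = Θ_w(t·S)` for `Θ_w(u) = R(u)·w` and any `S ⊆ ∏ᵢ 𝔸_{Kᵢ,f}` — the shape in which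
«`(r(s)·a)·ẑ^{2g}` is the image of `N_Φ(s)·(lattice)`» is read. [cite: Deligne1971TravauxShimura, 3.9 p. 140 and 4.18 p. 150]
[cite: Milne2005ShimuraVarieties, Def. 12.8 (60)–(62) p. 114] -/
theorem image_cmRepMatrix_mulVec_image (t : Π i, FiniteAdeleRing (𝓞 (K i)) (K i)) (w : Fin g ⊕ Fin g → finAdeleQ)
    (S : Set (Π i, FiniteAdeleRing (𝓞 (K i)) (K i))) :
    (fun y => c.cmRepMatrix t *ᵥ y) '' ((fun u => c.cmRepMatrix u *ᵥ w) '' S) =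
      (fun u => c.cmRepMatrix u *ᵥ w) '' ((fun u => t * u) '' S) := by
  rw [Set.image_image, Set.image_image]
  refine Set.image_congr' fun u => ?_
  rw [c.cmRepMatrix_mul_mulVec]

/-! ### §2. `act` over `𝔸_{ℚ,f}` on the vector `v ⊗ 1` -/

omit [DecidableEq ι] in
/-- **`(act x)_𝔸 · (v ⊗ 1) = (act(x)·v) ⊗ 1`**: the base-changed matrix of `act x` applied to the constant-coefficient vector
`(v_j)_j ↦ (v_j · 1_𝔸)_j` is the image of `act(x)·v`. [cite: Deligne1971TravauxShimura, 4.18 p. 150] -/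
theorem map_actMatrix_mulVec_algebraMap (x : Π i, K i) (v : Fin g ⊕ Fin g → ℚ) :
    (c.actMatrix x).map (algebraMap ℚ finAdeleQ) *ᵥ (fun j => algebraMap ℚ finAdeleQ (v j)) =
      fun j => algebraMap ℚ finAdeleQ (c.act x v j) := by
  funext j
  rw [← LinearMap.toMatrix'_mulVec, ← actMatrix_def]
  exact (RingHom.map_mulVec (algebraMap ℚ finAdeleQ) (c.actMatrix x) v j).symm

/-! ### §3. The cyclic vector stays cyclic adelically -/

/-- **`𝔸_{ℚ,f}^{2g}` IS FREE OF RANK ONE OVER `∏ᵢ 𝔸_{Kᵢ,f}` THROUGH `R`, with generator `v ⊗ 1` for any cyclic vector `v` of `act`**: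
if `x ↦ act(x)·v : F → ℚ^{2g}` is bijective (★ R60-14 `exists_bijective_act`) then
`t ↦ R(t)·(v ⊗ 1) : ∏ᵢ 𝔸_{Kᵢ,f} → 𝔸_{ℚ,f}^{2g}` is bijective.  Proof: through `∏ᵢ 𝔸_{Kᵢ,f} ≅ ∏ᵢ (𝔸_{ℚ,f} ⊗ Kᵢ) ≅ 𝔸_{ℚ,f} ⊗ F`
(★ `ratFiniteAdeleTensorEquiv`, `piRight`) and `R = Θ ∘ (e⁻¹)` (★ `cmRepMatrix_eq_algHom`) the map is the base change
`𝔸_{ℚ,f} ⊗_ℚ (F ≅ ℚ^{2g})` followed by `𝔸_{ℚ,f} ⊗ ℚ^{2g} ≅ 𝔸_{ℚ,f}^{2g}` (`piScalarRight`) — equality of the two `𝔸_{ℚ,f}`-linear maps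
is checked on pure tensors `a ⊗ x`, where both give `(a · act(x)·v_j)_j`.
[cite: Deligne1971TravauxShimura, 3.9 p. 140 and 4.18 p. 150] [cite: Milne2005ShimuraVarieties, §14 Def. 14.9 p. 123, Cor. 14.11 p. 124]
[cite: CasselsFrohlichANT1967, Ch. II §14 Lemma (14.2)] -/
theorem bijective_cmRepMatrix_mulVec_of_bijective_act {v : Fin g ⊕ Fin g → ℚ}
    (hv : Bijective fun x : Π i, K i => c.act x v) :
    Bijective fun t : Π i, FiniteAdeleRing (𝓞 (K i)) (K i) =>
      c.cmRepMatrix t *ᵥ (fun j => algebraMap ℚ finAdeleQ (v j)) := by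
  classical
  obtain ⟨Θ, hΘ⟩ := c.exists_algHom_extending_actMatrix
  set w : Fin g ⊕ Fin g → finAdeleQ := fun j => algebraMap ℚ finAdeleQ (v j) with hw
  -- the `𝔸`-linear orbit map `Ψ : u ↦ Θ(u)·w` on `∏ᵢ (𝔸 ⊗ Kᵢ)`
  let ev : Matrix (Fin g ⊕ Fin g) (Fin g ⊕ Fin g) finAdeleQ →ₗ[finAdeleQ] (Fin g ⊕ Fin g → finAdeleQ) :=
    { toFun := fun M => M *ᵥ w
      map_add' := fun M N => Matrix.add_mulVec M N w
      map_smul' := fun a M => Matrix.smul_mulVec a M w }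
  let Ψ : (Π i, finAdeleQ ⊗[ℚ] K i) →ₗ[finAdeleQ] (Fin g ⊕ Fin g → finAdeleQ) := ev ∘ₗ Θ.toLinearMap
  have hΨ : ∀ u, Ψ u = Θ u *ᵥ w := fun u => rfl
  -- the comparison isomorphism `E : 𝔸 ⊗ F ≅ 𝔸 ⊗ ℚ^{2g} ≅ 𝔸^{2g}`
  let q : (Π i, K i) ≃ₗ[ℚ] (Fin g ⊕ Fin g → ℚ) :=
    LinearEquiv.ofBijective ((LinearMap.applyₗ v).comp c.act.toLinearMap) hv
  have hq : ∀ x, q x = c.act x v := fun x => rfl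
  let E : finAdeleQ ⊗[ℚ] (Π i, K i) ≃ₗ[finAdeleQ] (Fin g ⊕ Fin g → finAdeleQ) :=
    (q.baseChange ℚ finAdeleQ (Π i, K i) (Fin g ⊕ Fin g → ℚ)).trans
      (TensorProduct.piScalarRight ℚ finAdeleQ finAdeleQ (Fin g ⊕ Fin g))
  let P : finAdeleQ ⊗[ℚ] (Π i, K i) ≃ₗ[finAdeleQ] (Π i, finAdeleQ ⊗[ℚ] K i) :=
    (Algebra.TensorProduct.piRight ℚ finAdeleQ finAdeleQ K).toLinearEquiv
  -- `Ψ ∘ P = E`, checked on pure tensors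
  have hcomp : Ψ ∘ₗ P.toLinearMap = E.toLinearMap := by
    refine TensorProduct.AlgebraTensorModule.ext fun a x => ?_
    rw [LinearMap.comp_apply, LinearEquiv.coe_toLinearMap, LinearEquiv.coe_toLinearMap, hΨ]
    change Θ (Algebra.TensorProduct.piRight ℚ finAdeleQ finAdeleQ K (a ⊗ₜ[ℚ] x)) *ᵥ w =
      TensorProduct.piScalarRight ℚ finAdeleQ finAdeleQ (Fin g ⊕ Fin g)
        (q.baseChange ℚ finAdeleQ (Π i, K i) (Fin g ⊕ Fin g → ℚ) (a ⊗ₜ[ℚ] x))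
    rw [Algebra.TensorProduct.piRight_tmul, hΘ, LinearEquiv.baseChange_tmul, TensorProduct.piScalarRight_apply,
      TensorProduct.piScalarRightHom_tmul, Matrix.smul_mulVec, hw, c.map_actMatrix_mulVec_algebraMap x v, hq]
    funext j
    rw [Pi.smul_apply, smul_eq_mul, Algebra.smul_def, mul_comm]
  have hΨbij : Bijective Ψ := by
    have h2 : (Ψ : (Π i, finAdeleQ ⊗[ℚ] K i) → (Fin g ⊕ Fin g → finAdeleQ)) = E ∘ P.symm := by
      funext u
      have hu := LinearMap.congr_fun hcomp (P.symm u)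
      rw [LinearMap.comp_apply, LinearEquiv.coe_toLinearMap, LinearEquiv.coe_toLinearMap, LinearEquiv.apply_symm_apply] at hu
      exact hu
    rw [h2]
    exact E.bijective.comp P.symm.bijective
  -- transport along `∏ᵢ 𝔸_{Kᵢ,f} ≅ ∏ᵢ (𝔸 ⊗ Kᵢ)`
  let e : (Π i, FiniteAdeleRing (𝓞 (K i)) (K i)) ≃ (Π i, finAdeleQ ⊗[ℚ] K i) :=
    Equiv.piCongrRight fun i => (ratFiniteAdeleTensorEquiv (K i)).symm.toEquiv
  have h3 : (fun t : Π i, FiniteAdeleRing (𝓞 (K i)) (K i) => c.cmRepMatrix t *ᵥ w) = Ψ ∘ e := by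
    funext t
    rw [Function.comp_apply, hΨ, c.cmRepMatrix_eq_algHom Θ hΘ]
    rfl
  rw [h3]
  exact hΨbij.comp e.bijective

/-- **A generator exists: `∃ w ∈ 𝔸_{ℚ,f}^{2g}` with `t ↦ R(t)·w : ∏ᵢ 𝔸_{Kᵢ,f} → 𝔸_{ℚ,f}^{2g}` bijective** — `𝔸_{ℚ,f}^{2g}` is free of
rank one over `F ⊗ 𝔸_{ℚ,f}` for every CM structure of type `δ` (`w = v ⊗ 1` for a cyclic vector `v` of ★ R60-14 `exists_bijective_act`).
[cite: Deligne1971TravauxShimura, 3.9 p. 140 and 4.18 p. 150] [cite: Milne2005ShimuraVarieties, §14 Def. 14.9 p. 123, Cor. 14.11 p. 124] -/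
theorem exists_bijective_cmRepMatrix_mulVec :
    ∃ w : Fin g ⊕ Fin g → finAdeleQ, Bijective fun t : Π i, FiniteAdeleRing (𝓞 (K i)) (K i) => c.cmRepMatrix t *ᵥ w := by
  obtain ⟨v, hv⟩ := c.exists_bijective_act
  exact ⟨fun j => algebraMap ℚ finAdeleQ (v j), c.bijective_cmRepMatrix_mulVec_of_bijective_act hv⟩

/-- The generator may be taken RATIONAL (`w = v ⊗ 1` with `v ∈ ℚ^{2g}` a cyclic vector of `act`), so that the rational structure
`ℚ^{2g} ⊂ 𝔸_{ℚ,f}^{2g}` corresponds to `F ⊂ F ⊗ 𝔸_{ℚ,f}`: `R(x ⊗ 1)·(v ⊗ 1) = (act(x)·v) ⊗ 1` for `x ∈ F`.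
[cite: Deligne1971TravauxShimura, 3.9 p. 140 and 4.18 p. 150] [cite: Milne2005ShimuraVarieties, §14 Def. 14.9 p. 123, Cor. 14.11 p. 124] -/
theorem exists_bijective_cmRepMatrix_mulVec_rational :
    ∃ v : Fin g ⊕ Fin g → ℚ, (Bijective fun x : Π i, K i => c.act x v) ∧
      (Bijective fun t : Π i, FiniteAdeleRing (𝓞 (K i)) (K i) =>
        c.cmRepMatrix t *ᵥ (fun j => algebraMap ℚ finAdeleQ (v j))) ∧
      ∀ x : Π i, K i,
        c.cmRepMatrix (fun i => ratFiniteAdeleTensorEquiv (K i) ((1 : finAdeleQ) ⊗ₜ[ℚ] x i)) *ᵥ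
            (fun j => algebraMap ℚ finAdeleQ (v j)) =
          fun j => algebraMap ℚ finAdeleQ (c.act x v j) := by
  obtain ⟨v, hv⟩ := c.exists_bijective_act
  refine ⟨v, hv, c.bijective_cmRepMatrix_mulVec_of_bijective_act hv, fun x => ?_⟩
  obtain ⟨Θ, hΘ⟩ := c.exists_algHom_extending_actMatrix
  rw [c.cmRepMatrix_eq_algHom Θ hΘ]
  have h : (fun i => (ratFiniteAdeleTensorEquiv (K i)).symm
      (ratFiniteAdeleTensorEquiv (K i) ((1 : finAdeleQ) ⊗ₜ[ℚ] x i))) = fun i => (1 : finAdeleQ) ⊗ₜ[ℚ] x i := by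
    funext i
    rw [RingEquiv.symm_apply_apply]
  rw [h, hΘ, one_smul, c.map_actMatrix_mulVec_algebraMap]

end CMStructure

end Literature.AlgebraicGeometry.ModuliOfAbelianVarieties

end
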